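import Literature.NumberTheory.EllipticCurves.PadicLogFiniteExtension
import HarnessLib

/-!
# The chart calculus and the logarithm `log_ω` do not depend on the choice of an EQUIVALENT
# valuation: `kernel`, `level`, `limitLog`, `padicLogPointFiniteExt` under `Valuation.IsEquiv`

Topic `NumberTheory/EllipticCurves`; namespace `Literature.NumberTheory.EllipticCurves.FormalGroupChart`
(the vocabulary of `FormalGroupChart`, `FormalGroupChartLevel`, `PadicLogFiniteExtension`).

## Why

The Literature logarithm `FormalGroupChart.padicLogPointFiniteExt w V p` of a point of a
`w`-integral Weierstrass equation over a valued field `(K, w : Valuation K ℝ≥0)` is consumed with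
DIFFERENT but EQUIVALENT `ℝ≥0`-valued valuations on the same field: on the completion
`L_w = w.adicCompletion L` of a number field, Mathlib's norm `‖·‖` has base `N(w)`
(`instNormedFieldValuedAdicCompletion`), the cell `bsd-addord`'s K-port uses the re-normed
synonym with base `p` (so that `‖p‖ = p⁻¹` and `L_w` is a normed `ℚ_p`-algebra), and the cite fact
(S5b) `PAdicHodge.exists_smul_range_expStarCoord_iff_trace_log` binds an arbitrary `w` compatible
with the valuative relation (`[w.Compatible]`); any two of these are `Valuation.IsEquiv`
(`ValuativeRel.isEquiv` for compatible ones).  Since every notion of the chart calculus is defined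
by INEQUALITIES between values of field elements, all of them are invariant under `IsEquiv`; this
file records that, so that a statement proved for one choice transfers verbatim to the others.

## What is here (for `h : w₁.IsEquiv w₂`, `w₁ w₂ : Valuation K ℝ≥0`)

* `integer_eq_of_isEquiv` (`𝒪_{w₁} = 𝒪_{w₂}`), `isIntegral_of_isEquiv` (integrality transfers);
* `mem_kernel_iff_of_isEquiv`, `kernel_eq_of_isEquiv` — `E₁` is the same subgroup;
* `level_eq_of_isEquiv` — `E⁽ᶜ⁾ = {P ∈ E₁ : |z P| ≤ |c|}` is the same for a threshold `|c|`, `c ∈ K`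
  (in particular the level `E⁽ᵖ⁾` of the limit logarithm);
* `limitLog_eq_of_isEquiv` — the limit logarithm `ℓ_p` is the same FUNCTION (including its junk
  values: the defining predicate `|y − z(pʳQ)/pʳ| ≤ |p|^{r+1} = |p^{r+1}|` is `IsEquiv`-invariant);
* `padicLogPointFiniteExt_eq_of_isEquiv` — **`log_ω` is the same function** for equivalent
  valuations (same admissible multipliers `m`, same `ℓ_p`).

Everything is proved by unfolding the definitions; no named facts, no instances, no notation.

## Sources

* J. H. Silverman, *The Arithmetic of Elliptic Curves*, 2nd ed., GTM 106 (2009), VII.1–VII.2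
  (the objects depend only on the valuation RING `R = {v(x) ≥ 0}`, i.e. on the place), IV.6.4.
* N. Bourbaki, *Commutative Algebra*, Ch. VI §3 no. 2 Prop. 3 (equivalent valuations = same
  valuation ring) — for the notion `Valuation.IsEquiv` (Mathlib `Valuation.isEquiv_iff_val_le_one`)
  [Bourbaki1989CommAlg].
-/

noncomputable section

open scoped Classical NNReal

namespace Literature.NumberTheory.EllipticCurves.FormalGroupChart

variable {K : Type*} [Field K] {w₁ w₂ : Valuation K ℝ≥0}

/-! ### The valuation ring and integrality -/

/-- Equivalent valuations have the same valuation ring `𝒪 = {x : |x| ≤ 1}` (Bourbaki, *Commutative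
Algebra* VI §3 no. 2 Prop. 3; Mathlib `Valuation.isEquiv_iff_val_le_one`). [cite: Bourbaki1989CommAlg, Ch. VI §3 no. 2 Prop. 3] -/
theorem integer_eq_of_isEquiv (h : w₁.IsEquiv w₂) : w₁.integer = w₂.integer := by
  ext x
  exact h.le_one_iff_le_one

/-- Integrality of a Weierstrass equation transfers along an equivalence of valuations (same
valuation ring). [cite: SilvermanAEC2009, VII.1 (Weierstrass equations with coefficients in R, PDF p. 165)] -/
theorem isIntegral_of_isEquiv (h : w₁.IsEquiv w₂) (V : WeierstrassCurve K) [hV : V.IsIntegral w₁.integer] :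
    V.IsIntegral w₂.integer :=
  isIntegral_integer_of_val_le_one
    (h.le_one_iff_le_one.mp val_a₁_le_one) (h.le_one_iff_le_one.mp val_a₂_le_one)
    (h.le_one_iff_le_one.mp val_a₃_le_one) (h.le_one_iff_le_one.mp val_a₄_le_one)
    (h.le_one_iff_le_one.mp val_a₆_le_one)

/-! ### The kernel of reduction and the levels -/

variable {V : WeierstrassCurve K} [hV₁ : V.IsIntegral w₁.integer] [hV₂ : V.IsIntegral w₂.integer]

/-- Membership in the kernel of reduction `E₁` (`|x(P)| > 1`) is the same for equivalent
valuations. [cite: SilvermanAEC2009, Prop. VII.2.2] -/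
theorem mem_kernel_iff_of_isEquiv (h : w₁.IsEquiv w₂) {P : V.toAffine.Point} :
    P ∈ kernel w₁ V ↔ P ∈ kernel w₂ V := by
  constructor
  · intro hP x y hxy he
    exact h.one_lt_iff_one_lt.mp (hP he)
  · intro hP x y hxy he
    exact h.one_lt_iff_one_lt.mpr (hP he)

/-- **`E₁` is the same subgroup for equivalent valuations.** [cite: SilvermanAEC2009, Prop. VII.2.2] -/
theorem kernel_eq_of_isEquiv (h : w₁.IsEquiv w₂) : kernel w₁ V = kernel w₂ V := by
  ext P
  exact mem_kernel_iff_of_isEquiv h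

/-- **The level `E⁽ᶜ⁾ = {P ∈ E₁ : |z(P)| ≤ |c|}` with a threshold `|c|`, `c ∈ K`, is the same
subgroup for equivalent valuations** — in particular the level `E⁽ᵖ⁾` (`c = p`) of the limit
logarithm. [cite: SilvermanAEC2009, Prop. IV.3.2(a) with Prop. VII.2.2] -/
theorem level_eq_of_isEquiv (h : w₁.IsEquiv w₂) (c : K) : level w₁ V (w₁ c) = level w₂ V (w₂ c) := by
  ext P
  rw [mem_level_iff, mem_level_iff, mem_kernel_iff_of_isEquiv h, h.le_iff_le]

/-! ### The limit logarithm and `log_ω` -/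

omit hV₁ hV₂ in
/-- The defining predicate of `limitLog` — "`y` approximates `z(pʳ·Q)/pʳ` to within `|p|^{r+1}` for
every `r`" — is invariant under equivalence of valuations (`|p|^{r+1} = |p^{r+1}|`). [folklore] -/
private theorem limitLog_pred_iff_of_isEquiv (h : w₁.IsEquiv w₂) (p : ℕ) (Q : V.toAffine.Point) (y : K) :
    (∀ r : ℕ, w₁ (y - ((p ^ r) • Q).zCoord / (p : K) ^ r) ≤ w₁ (p : K) ^ (r + 1)) ↔
      ∀ r : ℕ, w₂ (y - ((p ^ r) • Q).zCoord / (p : K) ^ r) ≤ w₂ (p : K) ^ (r + 1) := by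
  refine forall_congr' fun r => ?_
  rw [← map_pow, ← map_pow, h.le_iff_le]

omit hV₁ hV₂ in
/-- Auxiliary: a `dite` on `∃ y, P y` returning `Classical.choose` depends only on the predicate. [folklore] -/
private theorem dite_exists_choose_congr {P Q : K → Prop} (hPQ : P = Q) :
    (if hP : ∃ y, P y then Classical.choose hP else (0 : K)) =
      if hQ : ∃ y, Q y then Classical.choose hQ else 0 := by
  subst hPQ
  rfl

omit hV₁ hV₂ in
/-- **The limit logarithm `ℓ_p = limitLog` is the same function for equivalent valuations**
(including its junk values off the domain of convergence). [cite: SilvermanAEC2009, Thm. IV.6.4 with Prop. VII.2.2] -/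
theorem limitLog_eq_of_isEquiv (h : w₁.IsEquiv w₂) (p : ℕ) : limitLog w₁ V p = limitLog w₂ V p := by
  funext Q
  have hP : (fun y : K => ∀ r : ℕ, w₁ (y - ((p ^ r) • Q).zCoord / (p : K) ^ r) ≤ w₁ (p : K) ^ (r + 1)) =
      fun y : K => ∀ r : ℕ, w₂ (y - ((p ^ r) • Q).zCoord / (p : K) ^ r) ≤ w₂ (p : K) ^ (r + 1) :=
    funext fun y => propext (limitLog_pred_iff_of_isEquiv h p Q y)
  unfold limitLog
  exact dite_exists_choose_congr hP

omit hV₁ hV₂ in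
/-- Auxiliary: a `dite` on `∃ m, P m` evaluating a function at `Nat.find` depends only on the
predicate and the function (the `DecidablePred` instances are subsingletons). [folklore] -/
private theorem dite_exists_find_congr {P Q : ℕ → Prop} [DecidablePred P] [DecidablePred Q]
    (hPQ : P = Q) {f g : ℕ → K} (hfg : f = g) :
    (if hP : ∃ m, P m then f (Nat.find hP) else (0 : K)) =
      if hQ : ∃ m, Q m then g (Nat.find hQ) else 0 := by
  subst hPQ
  subst hfg
  congr!

/-- **`log_ω = padicLogPointFiniteExt` is the same function for equivalent valuations** (same
level `E⁽ᵖ⁾`, hence the same admissible multipliers `m` and the same least one `m₀`, and the same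
`ℓ_p`): a statement about `log_ω` proved for one `ℝ≥0`-valued valuation of a place transfers
verbatim to any equivalent one (Mathlib's norm on `K_v`, a re-normed synonym, any `w` compatible
with the valuative relation). [cite: SilvermanAEC2009, Thm. IV.6.4 with Prop. VII.2.2] [cite: MazurTateTeitelbaum1986, §II] -/
theorem padicLogPointFiniteExt_eq_of_isEquiv (h : w₁.IsEquiv w₂) (p : ℕ) :
    padicLogPointFiniteExt w₁ V p = padicLogPointFiniteExt w₂ V p := by
  funext P
  have hlev : level w₁ V (w₁ (p : K)) = level w₂ V (w₂ (p : K)) := level_eq_of_isEquiv h (p : K)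
  have hP : (fun m : ℕ => 0 < m ∧ m • P ∈ level w₁ V (w₁ (p : K))) =
      fun m : ℕ => 0 < m ∧ m • P ∈ level w₂ V (w₂ (p : K)) := by
    funext m
    rw [hlev]
  have hf : (fun m : ℕ => limitLog w₁ V p (m • P) / (m : K)) =
      fun m : ℕ => limitLog w₂ V p (m • P) / (m : K) := by
    funext m
    rw [limitLog_eq_of_isEquiv h p]
  unfold padicLogPointFiniteExt
  exact dite_exists_find_congr hP hf

/-- Pointwise form of `padicLogPointFiniteExt_eq_of_isEquiv`. [cite: SilvermanAEC2009, Thm. IV.6.4 with Prop. VII.2.2] -/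
theorem padicLogPointFiniteExt_apply_eq_of_isEquiv (h : w₁.IsEquiv w₂) (p : ℕ) (P : V.toAffine.Point) :
    padicLogPointFiniteExt w₁ V p P = padicLogPointFiniteExt w₂ V p P := by
  rw [padicLogPointFiniteExt_eq_of_isEquiv h p]

end Literature.NumberTheory.EllipticCurves.FormalGroupChart

end
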